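import Literature.NumberTheory.GaloisRepresentations.CohomologicalDimensionTowerProofs
import Literature.NumberTheory.GaloisRepresentations.GaloisCohomologyInfResProofs
import HarnessLib

/-!
# Inflation–restriction in degree two, in vanishing form (Serre I §2.6 (b); Shatz II §4 (25))

For a profinite group `G`, a closed normal subgroup `N` and a discrete `G`-module `A` with
`H¹(N, A) = 0`, the sequence `0 → H²(G/N, A^N) →(inf) H²(G, A) →(res) H²(N, A)` is exact
(Serre, *Cohomologie galoisienne*, I §2.6 (b): "si `H^i(H, A) = 0` pour `1 ≤ i < q` … la suite
`0 → H^q(G/H, A^H) → H^q(G, A) → H^q(H, A)` est exacte"; Hochschild–Serre; Shatz, *Profinite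
groups, arithmetic, and geometry*, II §4 (24)–(25); Serre, *Corps locaux*, VII §6 Prop. 5).  This
file proves the consequence used by descent arguments, **in vanishing form and at the level of a
single class**:

* `exists_d_eq_of_res_eq_d_two` — if `H¹(N, A) = 0` and `H²(G/N, A^N) = 0`, then every continuous
  homogeneous `2`-cocycle of `G` with values in `A` whose restriction to `N` is a coboundary is a
  coboundary;
* `subsingleton_two_of_quotient_of_subgroup` — in particular `H¹(N, A) = 0`, `H²(G/N, A^N) = 0`
  and `H²(N, A) = 0` give `H²(G, A) = 0`.

The proof is the classical dimension shift from degree one (*Corps locaux* VII §6, proof of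
Prop. 5), run on cochains with the tree's ingredients: embed `A` in the coinduced module
`I = C(G, A)` with quotient `Q` (`ContinuousRep.coindι/coindπ`, `DiscreteCochains.lean`); `I` is
`G`-acyclic, `N`-acyclic and `I^N` is `G/N`-acyclic (`subsingleton_coind`,
`subsingleton_coind_restrict`, `subsingleton_coind_invariants`, `CohomologicalDimensionTowerProofs`);
`0 → A^N → I^N → Q^N → 0` is exact as `H¹(N, A) = 0` (`isSES_invariants`), whence
`H¹(G/N, Q^N) = 0`; a `2`-cocycle `a` of `A` gives a `1`-cocycle `q` of `Q` whose restriction to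
`N` is a coboundary, hence `[q]` is inflated (inflation–restriction in degree one,
`ContinuousCohomology.exact_inf_res_one` of `GaloisCohomologyInfResProofs.lean`) from
`H¹(G/N, Q^N) = 0`, so `q` is a coboundary, and then so is `a`.

## References

* J.-P. Serre, *Cohomologie galoisienne*, 5e éd., LNM 5 (1994) / *Galois Cohomology* (1997),
  I §2.6 (b). [SerreGaloisCohomology1997]
* S. S. Shatz, *Profinite groups, arithmetic, and geometry* (1972), Ch. II §4, (24)–(25).
  [Shatz1972]
* J. Neukirch, A. Schmidt, K. Wingberg, *Cohomology of Number Fields* (2008), (1.6.7).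
  [NeukirchSchmidtWingberg2008]
-/

noncomputable section

open CategoryTheory Topology Set

universe u

namespace Literature.NumberTheory.GaloisRepresentations

open _root_.TopRep _root_.ContRepresentation _root_.ContinuousCohomology

set_option allowUnsafeReducibility true in
attribute [local reducible] CategoryTheory.Functor.mapHomologicalComplex

/-! ### Restriction of cochains to a subgroup -/

section Res

variable {k : Type*} [CommRing k] [TopologicalSpace k]
variable {G : Type u} [Group G] [TopologicalSpace G] [IsTopologicalGroup G]
variable (N : Subgroup G)
variable {M : Type u} [AddCommGroup M] [Module k M] [TopologicalSpace M] [DiscreteTopology M]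
  [ContinuousSMul k M]
variable {M' : Type u} [AddCommGroup M'] [Module k M'] [TopologicalSpace M'] [DiscreteTopology M']
  [ContinuousSMul k M']

/-- Restriction of a morphism of discrete `G`-modules to a subgroup `N`, for any coefficient ring
`k`.  This is the survivor of the pair `resModHom` / `restrictHom`: the tree's `restrictHom`
(`CohomologicalDimensionTowerProofs.lean`, coefficients `ℤ`, stated under `[CompactSpace G]`) is
its `ℤ`-specialisation, the same term (`restrictHom_eq_resModHom`), and is to be retired in its
favour; the generic coefficients are what lets the lemmas below apply to quotient modules such as
`coindQuot` without unfolding the `ℤ`-module structure. [folklore] -/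
def resModHom {ρ : ContinuousRep G k M} {ρ' : ContinuousRep G k M'} (f : ρ.toTopRep ⟶ ρ'.toTopRep) :
    (ρ.restrict (subgroupIncl N)).toTopRep ⟶ (ρ'.restrict (subgroupIncl N)).toTopRep :=
  TopRep.ofHom ⟨f.hom.toContinuousLinearMap, fun n => f.hom.isIntertwining' (n : G)⟩

omit [IsTopologicalGroup G] in
/-- `resModHom` is `f` on elements. [folklore] -/
@[simp] theorem resModHom_hom_apply {ρ : ContinuousRep G k M} {ρ' : ContinuousRep G k M'}
    (f : ρ.toTopRep ⟶ ρ'.toTopRep) (m : M) : (resModHom N f).hom m = f.hom m := rfl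

omit [IsTopologicalGroup G] in
/-- The tree's `restrictHom` (coefficients `ℤ`) **is** `resModHom`: same term; `restrictHom` is the
specialisation to be retired (see `resModHom`). [folklore] -/
@[simp] theorem restrictHom_eq_resModHom [IsTopologicalGroup G] [CompactSpace G]
    {M₀ : Type u} [AddCommGroup M₀] [TopologicalSpace M₀] [DiscreteTopology M₀]
    {M₀' : Type u} [AddCommGroup M₀'] [TopologicalSpace M₀'] [DiscreteTopology M₀']
    {ρ : ContinuousRep G ℤ M₀} {ρ' : ContinuousRep G ℤ M₀'} (f : ρ.toTopRep ⟶ ρ'.toTopRep) :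
    restrictHom N f = resModHom N f := rfl

omit [IsTopologicalGroup G] in
/-- `resModHom` preserves vanishing composites. [folklore] -/
theorem resModHom_comp_eq_zero {M'' : Type u} [AddCommGroup M''] [Module k M'']
    [TopologicalSpace M''] [DiscreteTopology M''] [ContinuousSMul k M'']
    {ρ : ContinuousRep G k M} {ρ' : ContinuousRep G k M'} {ρ'' : ContinuousRep G k M''}
    (f : ρ.toTopRep ⟶ ρ'.toTopRep) (g : ρ'.toTopRep ⟶ ρ''.toTopRep) (hfg : f ≫ g = 0) :
    resModHom N f ≫ resModHom N g = 0 := by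
  ext m
  exact congr(($hfg).hom m)

/-- The restriction of homogeneous cochains to a subgroup `N` (Mathlib's `cochainsMap` along the
inclusion `N →ₜ* G` and the identity of the module; `res (N ↪ G) ρ = ρ|_N` definitionally).
[folklore] -/
abbrev resCochains (ρ : ContinuousRep G k M) :
    homogeneousCochains ρ.toTopRep ⟶ homogeneousCochains (ρ.restrict (subgroupIncl N)).toTopRep :=
  cochainsMap (subgroupIncl N) (𝟙 ((ρ.restrict (subgroupIncl N)).toTopRep))

/-- Restriction of the terms of the standard resolution commutes with a morphism of modules,
on elements. [folklore] -/
theorem resolutionMap_resolutionHom {ρ : ContinuousRep G k M} {ρ' : ContinuousRep G k M'}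
    (f : ρ.toTopRep ⟶ ρ'.toTopRep) :
    ∀ (m : ℕ) (w : resolutionX ρ.toTopRep m),
      (resolutionMap (subgroupIncl N) (𝟙 ((ρ'.restrict (subgroupIncl N)).toTopRep)) m).hom
          ((resolutionHom f m).hom w) =
        (resolutionHom (resModHom N f) m).hom
          ((resolutionMap (subgroupIncl N) (𝟙 ((ρ.restrict (subgroupIncl N)).toTopRep)) m).hom w)
  | 0, _ => rfl
  | m + 1, F => by
    ext x : 1
    exact resolutionMap_resolutionHom f m _

/-- **Restriction commutes with morphisms of coefficient modules**:
`res ∘ H(f) = H(f|_N) ∘ res` on cochains. [folklore] -/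
theorem resCochains_cochainsHom {ρ : ContinuousRep G k M} {ρ' : ContinuousRep G k M'}
    (f : ρ.toTopRep ⟶ ρ'.toTopRep) (i : ℕ) (σ : (homogeneousCochains ρ.toTopRep).X i) :
    (resCochains N ρ').f i ((cochainsHom f).f i σ) =
      (cochainsHom (resModHom N f)).f i ((resCochains N ρ).f i σ) :=
  Subtype.ext (resolutionMap_resolutionHom N f (i + 1) σ.1)

end Res

/-! ### The inclusion `Q^N → Q` as a morphism from the restriction of the `G/N`-module `Q^N` -/

section Inclusion

variable {k : Type*} [CommRing k] [TopologicalSpace k]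
variable {G : Type u} [Group G] [TopologicalSpace G] [IsTopologicalGroup G]
variable (N : Subgroup G) [N.Normal]
variable {M : Type u} [AddCommGroup M] [Module k M] [TopologicalSpace M] [DiscreteTopology M]
  [ContinuousSMul k M]
variable (ρ : ContinuousRep G k M)

/-- The inclusion `M^N → M`, `G`-equivariant from the restriction along `G → G/N` of the
`G/N`-module `M^N` (`ContinuousRep.quotientInvariants`) to `M`: the map `ι` of the
inflation–restriction sequence. [cite: SerreGaloisCohomology1997, I §2.6 (b)] -/
def invariantsInclusion :
    TopRep.res (ContinuousMonoidHom.quotientMk N : G →* G ⧸ N) (ρ.quotientInvariants N).toTopRep ⟶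
      ρ.toTopRep :=
  TopRep.ofHom
    { toLinearMap := (ρ.invariantsOf N).subtype
      cont := continuous_subtype_val
      isIntertwining' := fun _ => rfl }

/-- `invariantsInclusion` is the inclusion on elements. [folklore] -/
@[simp] theorem invariantsInclusion_hom_apply (w : ρ.invariantsOf N) :
    (invariantsInclusion N ρ).hom w = w := rfl

end Inclusion

/-! ### Inflation–restriction in degree two -/

section InfResTwo

variable {G : Type u} [Group G] [TopologicalSpace G] [IsTopologicalGroup G] [CompactSpace G]
  [T2Space G] [TotallyDisconnectedSpace G]
variable (N : Subgroup G) [N.Normal] [hN : IsClosed (N : Set G)]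
variable {M : Type u} [AddCommGroup M] [TopologicalSpace M] [DiscreteTopology M]
variable (ρ : ContinuousRep G ℤ M)

/-- **`H¹(G/N, Q^N) = 0`** for the dimension-shifting quotient `Q = C(G, A)/A`, from
`H¹(N, A) = 0` and `H²(G/N, A^N) = 0` (exactness of `0 → A^N → C(G,A)^N → Q^N → 0` and
`G/N`-acyclicity of `C(G, A)^N`). [cite: Shatz1972, Ch. II §4 (24)–(25)] -/
theorem subsingleton_one_coindQuot_quotientInvariants
    (h1 : Subsingleton (continuousCohomology 1 (ρ.restrict (subgroupIncl N)).toTopRep))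
    (h2 : Subsingleton (continuousCohomology 2 (ρ.quotientInvariants N).toTopRep)) :
    Subsingleton (continuousCohomology 1 (ρ.coindQuot.quotientInvariants N).toTopRep) :=
  (isSES_invariants N ρ h1).subsingleton_X₃ 0 (subsingleton_coind_invariants N ρ 0) h2

omit [CompactSpace G] [T2Space G] [TotallyDisconnectedSpace G] hN in
/-- **Inflation–restriction in degree one** for a discrete module `B` over a profinite group and
a closed normal subgroup `N`, in the concrete form used here: exactness of
`H¹(G/N, B^N) →(inf) H¹(G, B) →(res) H¹(N, B)` (an instance of
`ContinuousCohomology.exact_inf_res_one`). [cite: SerreGaloisCohomology1997, I §2.6 (b)] -/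
theorem exact_inf_res_one_discrete {k : Type*} [CommRing k] [TopologicalSpace k] {B : Type u}
    [AddCommGroup B] [Module k B] [TopologicalSpace B] [DiscreteTopology B] [ContinuousSMul k B]
    (τ : ContinuousRep G k B) :
    Function.Exact
      (ContinuousCohomology.map (ContinuousMonoidHom.quotientMk N) (invariantsInclusion N τ) 1).hom
      (ContinuousCohomology.map (subgroupIncl N)
        (𝟙 ((τ.restrict (subgroupIncl N)).toTopRep)) 1).hom :=
  ContinuousCohomology.exact_inf_res_one (X := τ.toTopRep)
    (Y := (τ.restrict (subgroupIncl N)).toTopRep) N (invariantsInclusion N τ) (subgroupIncl N)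
    (𝟙 ((τ.restrict (subgroupIncl N)).toTopRep)) Subtype.val_injective IsInducing.subtypeVal
    (fun m hm => ⟨⟨m, fun n => hm n n.2⟩, rfl⟩) (fun n => n.2) (fun s hs => ⟨⟨s, hs⟩, rfl⟩)
    Function.bijective_id τ.continuous_apply_left

omit [CompactSpace G] [T2Space G] [TotallyDisconnectedSpace G] hN in
/-- **Inflation–restriction in degree one, vanishing form, for one class**: if
`H¹(G/N, B^N) = 0`, a continuous `1`-cocycle of `G` with values in the discrete module `B` whose
restriction to `N` is a coboundary is a coboundary (`exact_inf_res_one_discrete`).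
[cite: SerreGaloisCohomology1997, I §2.6 (b)] -/
theorem exists_d_eq_of_res_eq_d_one {k : Type*} [CommRing k] [TopologicalSpace k] {B : Type u}
    [AddCommGroup B] [Module k B] [TopologicalSpace B] [DiscreteTopology B] [ContinuousSMul k B]
    (τ : ContinuousRep G k B)
    (hQ : Subsingleton (continuousCohomology 1 (τ.quotientInvariants N).toTopRep))
    (q : (homogeneousCochains τ.toTopRep).X 1) (hq : (homogeneousCochains τ.toTopRep).d 1 2 q = 0)
    (hres : ∃ c : (homogeneousCochains (τ.restrict (subgroupIncl N)).toTopRep).X 0,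
      (homogeneousCochains (τ.restrict (subgroupIncl N)).toTopRep).d 0 1 c = (resCochains N τ).f 1 q) :
    ∃ e : (homogeneousCochains τ.toTopRep).X 0, (homogeneousCochains τ.toTopRep).d 0 1 e = q := by
  obtain ⟨c, hc⟩ := hres
  have hclass : (ContinuousCohomology.map (X := τ.toTopRep) (subgroupIncl N)
      (𝟙 ((τ.restrict (subgroupIncl N)).toTopRep)) 1).hom
      (cxClass (homogeneousCochains τ.toTopRep) 1 2 up_nat_next_one q hq) = 0 := by
    change (HomologicalComplex.homologyMap (resCochains N τ) 1)
      (cxClass (homogeneousCochains τ.toTopRep) 1 2 up_nat_next_one q hq) = 0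
    rw [homologyMap_cxClass (resCochains N τ) 1 2 up_nat_next_one q hq ((resCochains N τ).f 1 q)
      (by rw [hom_f_d_apply, hq, map_zero]) rfl,
      cxClass_eq_zero_iff _ 1 2 up_nat_next_one 0 up_nat_prev_one]
    exact ⟨c, hc⟩
  obtain ⟨z, hz⟩ := (exact_inf_res_one_discrete N τ _).1 hclass
  have hz0 : z = 0 := Subsingleton.elim z 0
  have hq0 : cxClass (homogeneousCochains τ.toTopRep) 1 2 up_nat_next_one q hq = 0 := by
    rw [← hz, hz0]
    exact map_zero _
  exact (cxClass_eq_zero_iff _ 1 2 up_nat_next_one 0 up_nat_prev_one q hq).1 hq0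

-- The six-step chase below elaborates many morphisms between the complexes of five modules
-- (`A`, `C(G, A)`, `Q` and their restrictions); it needs about twice the default heartbeats.
set_option maxHeartbeats 800000 in
/-- **Inflation–restriction in degree two, vanishing form** (Serre I §2.6 (b) with `q = 2`):
let `N` be a closed normal subgroup of a profinite group `G` and `A` a discrete `G`-module with
`H¹(N, A) = 0` and `H²(G/N, A^N) = 0`.  Then a continuous homogeneous `2`-cocycle `a` of `G`
with values in `A` whose restriction to `N` is a coboundary is a coboundary.  (Dimension shift
to degree one, `exists_d_eq_of_res_eq_d_one`, see the module docstring.)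
[cite: SerreGaloisCohomology1997, I §2.6 (b)] [cite: Shatz1972, Ch. II §4 (25)] -/
theorem exists_d_eq_of_res_eq_d_two
    (h1 : Subsingleton (continuousCohomology 1 (ρ.restrict (subgroupIncl N)).toTopRep))
    (h2 : Subsingleton (continuousCohomology 2 (ρ.quotientInvariants N).toTopRep))
    (a : (homogeneousCochains ρ.toTopRep).X 2)
    (ha : (homogeneousCochains ρ.toTopRep).d 2 3 a = 0)
    (hres : ∃ bN : (homogeneousCochains (ρ.restrict (subgroupIncl N)).toTopRep).X 1,
      (homogeneousCochains (ρ.restrict (subgroupIncl N)).toTopRep).d 1 2 bN =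
        (resCochains N ρ).f 2 a) :
    ∃ b : (homogeneousCochains ρ.toTopRep).X 1, (homogeneousCochains ρ.toTopRep).d 1 2 b = a := by
  obtain ⟨bN, hbN⟩ := hres
  have hSES : IsSES ρ.coindι ρ.coindπ := isSES_coind ρ
  -- Step 1: `ι a` is a cocycle of the acyclic `I = C(G, A)`, hence `ι a = d b`
  have hI2 := subsingleton_coind ρ 1
  rw [subsingleton_homology_succ_iff] at hI2
  obtain ⟨b, hb⟩ := hI2 ((cochainsHom ρ.coindι).f 2 a) (by rw [hom_f_d_apply, ha, map_zero])
  have hb : (homogeneousCochains ρ.coind.toTopRep).d 1 2 b = (cochainsHom ρ.coindι).f 2 a := hb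
  -- Step 2: `q = π b` is a `1`-cocycle of `Q`
  have hq : (homogeneousCochains ρ.coindQuot.toTopRep).d 1 2 ((cochainsHom ρ.coindπ).f 1 b) = 0 := by
    rw [hom_f_d_apply, hb, cochainsHom_comp_apply_eq_zero ρ.coindι ρ.coindπ hSES.comp_eq_zero]
  -- Step 3: the restriction of `q` to `N` is a coboundary
  have hIN1 := subsingleton_coind_restrict N ρ 0
  rw [subsingleton_homology_succ_iff] at hIN1
  have hc : (homogeneousCochains (ρ.coind.restrict (subgroupIncl N)).toTopRep).d 1 2
      ((resCochains N ρ.coind).f 1 b - (cochainsHom (resModHom N ρ.coindι)).f 1 bN) = 0 := by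
    rw [map_sub, hom_f_d_apply (resCochains N ρ.coind) 1 2 b, hb, resCochains_cochainsHom,
      hom_f_d_apply (cochainsHom (resModHom N ρ.coindι)) 1 2 bN, hbN, sub_self]
  obtain ⟨c, hc'⟩ := hIN1 _ hc
  have hc' : (homogeneousCochains (ρ.coind.restrict (subgroupIncl N)).toTopRep).d 0 1 c =
      (resCochains N ρ.coind).f 1 b - (cochainsHom (resModHom N ρ.coindι)).f 1 bN := hc'
  have hresq : (homogeneousCochains (ρ.coindQuot.restrict (subgroupIncl N)).toTopRep).d 0 1
        ((cochainsHom (resModHom N ρ.coindπ)).f 0 c) =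
      (resCochains N ρ.coindQuot).f 1 ((cochainsHom ρ.coindπ).f 1 b) := by
    rw [resCochains_cochainsHom, hom_f_d_apply, hc', map_sub,
      cochainsHom_comp_apply_eq_zero (resModHom N ρ.coindι) (resModHom N ρ.coindπ)
        (resModHom_comp_eq_zero N _ _ hSES.comp_eq_zero), sub_zero]
  -- Steps 4–5: inflation–restriction in degree one for `Q`, and `H¹(G/N, Q^N) = 0`
  obtain ⟨e, he⟩ := exists_d_eq_of_res_eq_d_one N ρ.coindQuot
    (subsingleton_one_coindQuot_quotientInvariants N ρ h1 h2) _ hq ⟨_, hresq⟩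
  -- Step 6: lift `e = π b₀`; then `b - d b₀ = ι a₁` and `d a₁ = a`
  obtain ⟨b₀, rfl⟩ := cochainsHom_surjective ρ.coindπ hSES.surjective 0 e
  have h6 : (cochainsHom ρ.coindπ).f 1 (b - (homogeneousCochains ρ.coind.toTopRep).d 0 1 b₀) = 0 := by
    rw [map_sub, ← hom_f_d_apply, he, sub_self]
  obtain ⟨a₁, ha₁⟩ := cochainsHom_exact_mid ρ.coindι ρ.coindπ hSES.injective hSES.exact_mid 1 _ h6
  refine ⟨a₁, cochainsHom_injective ρ.coindι hSES.injective 2 ?_⟩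
  rw [← hom_f_d_apply, ha₁, map_sub, d_d_apply, sub_zero, hb]

/-- **Inflation–restriction in degree two, for whole groups**: if `H¹(N, A) = 0`,
`H²(G/N, A^N) = 0` and `H²(N, A) = 0`, then `H²(G, A) = 0` (closed normal `N` in a profinite
`G`, discrete `A`). [cite: SerreGaloisCohomology1997, I §2.6 (b)] [cite: Shatz1972, Ch. II §4 (25)] -/
theorem subsingleton_two_of_quotient_of_subgroup
    (h1 : Subsingleton (continuousCohomology 1 (ρ.restrict (subgroupIncl N)).toTopRep))
    (h2 : Subsingleton (continuousCohomology 2 (ρ.quotientInvariants N).toTopRep))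
    (hN2 : Subsingleton (continuousCohomology 2 (ρ.restrict (subgroupIncl N)).toTopRep)) :
    Subsingleton (continuousCohomology 2 ρ.toTopRep) := by
  rw [subsingleton_homology_succ_iff] at hN2 ⊢
  intro a ha
  refine exists_d_eq_of_res_eq_d_two N ρ h1 h2 a ha (hN2 _ ?_)
  rw [hom_f_d_apply, ha, map_zero]

end InfResTwo

end Literature.NumberTheory.GaloisRepresentations

end
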